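import Summits.QuantumFields.BalabanUV.Beta.FP.KKTCornerReduction
import Summits.QuantumFields.BalabanUV.Beta.FP.NestedStepLawSliced
import Summits.QuantumFields.BalabanUV.Beta.FP.CoarseJetUnit
import Literature.MathematicalPhysics.QuantumFieldTheory.Balaban1983to89.Beta.SliceComposition

/-!
# `BalabanUV.Beta.FP.EffFormTower` — road «FP» for binder row D1, ROUTE T, the (j, m) torus call for `m ≥ 2` (OWNER successor d1-p3 g19's memo §27,
# ask W-FP-19-13 (EFF-m), GENERIC HALF): **THE TOWER LAW OF SLICED EFFECTIVE FORMS** — integrating the fine field against the composite sliced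
# constraint `[Q₂Q₁; τ₂Q₁; τ₁]` leaves, on the coarsest average, the SAME effective form as integrating it against `[Q₁; τ₁]`, keeping the `μμ` corner,
# and integrating THAT against `[Q₂; τ₂]` (an5's `CompositionSingular.effForm_compForm` at `G := 0` + the `ρ`-KILLING ROWS DROPPING OUT OF THE
# EFFECTIVE FORM, the effective-form twin of the OWNER's `KKTCornerReduction.det_kkt_killRows`); plus the SCALING `effForm (c•H) C = c • effForm H C`

WHAT (all [folklore] Schur-complement algebra over an arbitrary field; nothing of the dictionary):
* §1 PINNING — `kktInv_killRows_regroup`: the `((μ ⊕ κ), (μ ⊕ κ))` block of `(kkt E [[P,0],[0,1]])⁻¹`, regrouped by `cornerRegroup`, IS `(kkt E₁₁ P)⁻¹`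
  (the corner `[[E₂₂,1],[1,0]]` is unimodular and its Schur correction vanishes); hence **`effForm_killRows_toBlocks₁₁ :
  (effForm E (fromBlocks P 0 0 1)).toBlocks₁₁ = effForm E.toBlocks₁₁ P`**, `minOp_killRows`, `flucCov_killRows` (the `μ`-rows ∕ columns) — under the ONE
  hypothesis `IsUnit (kkt E.toBlocks₁₁ P).det`.
* §2 TOWER — **`effForm_nested_toBlocks₁₁ (h1 : IsUnit (kkt H [Q₁;τ₁]).det) (h2 : IsUnit (kkt (effForm H [Q₁;τ₁]).toBlocks₁₁ [Q₂;τ₂]).det) :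
  (effForm H ([[Q₂,0],[τ₂,0],[0,1]] · [Q₁;τ₁])).toBlocks₁₁ = effForm (effForm H [Q₁;τ₁]).toBlocks₁₁ [Q₂;τ₂]`** and the same with the product
  multiplied out (`NestedStepLawSliced.nestedSlice_mul_fromRows`: `= [[Q₂Q₁; τ₂Q₁]; τ₁]`), `effForm_nested_corner` (the `κκ` corner two levels up).
* §3 SCALING — `kktInv_smul_form`, **`effForm_smul_form (hc : c ≠ 0) (h : IsUnit (kkt H C).det) : effForm (c • H) C = c • effForm H C`** (from leaf-05 g26's
  `CoarseJetUnit.kkt_smul_form_eq_conj`), `effForm_smul_form_toBlocks₁₁`.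
USE (memo §27 (EFF-m), the record half — a separate file once leaf-06's `TorusCompositeObjects` fixes `compRows ∕ nestedSlice`): by induction on `m`,
`S^{(m+1)}.toBlocks₁₁ = (effForm S^{(m)}.toBlocks₁₁ [Q_{j+m}; τ_{j+m}]).toBlocks₁₁` (§2) `= c_m • (effForm H₀^{(j+m)} [Q_{j+m}; τ_{j+m}]).toBlocks₁₁` (§3 + the
induction hypothesis) `= c_m · (wVH d Lc (j+m+1))⁻¹ • H₀^{(j+m+1)}` (leaf-05 g26's `RelInvPeriodisedEffFormCoarse.hId_order_zero_record` at level `j+m`).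

HONEST DEPENDENCY (page 1, mandatory): continuum YM on T⁴ ⇐ BetaPertH ∧ nine spine estimates (0/9 proved); BetaPertH ⇐ (D1) ∧ (D4) ∧ CAP+tail;
G-an2-4 gates asym, D1 and NE2/3/4.  HONEST FRAMING (cell contract, verbatim): «discharging `BetaPertH` makes Bałaban's UV stability UNCONDITIONAL —
a real constructive-QFT result; it is NOT the continuum limit and NOT the Clay problem.»  ABSOLUTE RULE (cell charter, verbatim): «No internally-minted
statement may enter as a cited fact. Every hypothesis is either kernel-proved in this package or a verbatim quotation of a PUBLISHED theorem with page
reference. The manuscript(s) under audit are NOT citable for their own disputed steps — they are the thing under adjudication; programme-internal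
(2001/route/tribunal) claims are never citable.»  [folklore] block algebra BY NAME (an5's `CompositionSingular`, the OWNER's `KKTCornerReduction` ∕
`NestedStepLawSliced`, Mathlib's `Matrix.invOf_fromBlocks₂₂_eq`); no `def`, no `def … : Prop`, nothing cited, 0 sorry; 0 estimates; 0∕4 row-D1 binders;
NOT (T-ID), NOT SDF, NOT D1, NOT BetaPertH, NOT continuum, NOT Clay.  D1 formalisation swarm LEAF PROVER 05 (b2b-balaban-beta-d1-formalise-leaf-05
gen 28), 2026-08-22.  No existing file touched.
-/

noncomputable section

namespace Summit.QuantumFields.BalabanUV.Beta.FP.EffFormTower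

open Matrix
open Literature.MathematicalPhysics.QuantumFieldTheory.Balaban1983to89.Beta.Composition (kkt compForm)
open Literature.MathematicalPhysics.QuantumFieldTheory.Balaban1983to89.Beta.CompositionSingular (effForm minOp minOpL flucCov effForm_compForm)
open Summit.QuantumFields.BalabanUV.Beta.FP.KKTCornerReduction (cornerRegroup cornerMid cornerMidInv cornerMidInvertible cornerMid_mul_cornerMidInv
  kkt_killRows_eq_submatrix det_kkt_killRows)
open Summit.QuantumFields.BalabanUV.Beta.FP.NestedStepLawSliced (nestedSlice_mul_fromRows)
open Summit.QuantumFields.BalabanUV.Beta.FP.RelInvPeriodisedCoarse (kkt_smul_form_mul)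
open Summit.QuantumFields.BalabanUV.Beta.FP.RelInvPeriodisedSliced (kkt_submatrix_equiv)
open Literature.MathematicalPhysics.QuantumFieldTheory.Balaban1983to89.Beta.SliceComposition (fromRows_assoc)

variable {𝕜 : Type*} [Field 𝕜]

/-! ## §1 Pinning: the `ρ`-killing rows drop out of the bordered inverse's `(μ ⊕ κ)` block -/

section Pinning

variable {μ κ ρ : Type*} [Fintype μ] [Fintype κ] [Fintype ρ] [DecidableEq μ] [DecidableEq κ] [DecidableEq ρ]

/-- [folklore] **THE `(μ ⊕ κ)` BLOCK OF `(kkt E [[P,0],[0,1]])⁻¹` IS `(kkt E₁₁ P)⁻¹`** (regrouped by `cornerRegroup`): the corner `[[E₂₂, 1],[1, 0]]`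
is unimodular and the Schur correction `[[E₁₂,0],[0,0]]·[[0,1],[1,−E₂₂]]·[[E₂₁,0],[0,0]]` vanishes identically. -/
theorem kktInv_killRows_regroup (E : Matrix (μ ⊕ ρ) (μ ⊕ ρ) 𝕜) (P : Matrix κ μ 𝕜) (h : IsUnit (kkt E.toBlocks₁₁ P).det) :
    (((kkt E (fromBlocks P (0 : Matrix κ ρ 𝕜) (0 : Matrix ρ μ 𝕜) (1 : Matrix ρ ρ 𝕜)))⁻¹).submatrix
        (cornerRegroup μ κ ρ).symm (cornerRegroup μ κ ρ).symm).toBlocks₁₁ = (kkt E.toBlocks₁₁ P)⁻¹ := by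
  letI : Invertible (cornerMid E.toBlocks₂₂) := cornerMidInvertible E.toBlocks₂₂
  have hinv : ⅟(cornerMid E.toBlocks₂₂) = cornerMidInv E.toBlocks₂₂ := rfl
  have hz : fromBlocks E.toBlocks₁₂ (0 : Matrix μ ρ 𝕜) (0 : Matrix κ ρ 𝕜) (0 : Matrix κ ρ 𝕜) * cornerMidInv E.toBlocks₂₂
      * fromBlocks E.toBlocks₂₁ (0 : Matrix ρ κ 𝕜) (0 : Matrix ρ μ 𝕜) (0 : Matrix ρ κ 𝕜) = 0 := by
    unfold KKTCornerReduction.cornerMidInv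
    rw [fromBlocks_multiply, fromBlocks_multiply, ← fromBlocks_zero]
    simp
  have hS : kkt E.toBlocks₁₁ P - fromBlocks E.toBlocks₁₂ (0 : Matrix μ ρ 𝕜) (0 : Matrix κ ρ 𝕜) (0 : Matrix κ ρ 𝕜) * ⅟(cornerMid E.toBlocks₂₂)
      * fromBlocks E.toBlocks₂₁ (0 : Matrix ρ κ 𝕜) (0 : Matrix ρ μ 𝕜) (0 : Matrix ρ κ 𝕜) = kkt E.toBlocks₁₁ P := by
    rw [hinv, hz, sub_zero]
  letI : Invertible (kkt E.toBlocks₁₁ P - fromBlocks E.toBlocks₁₂ (0 : Matrix μ ρ 𝕜) (0 : Matrix κ ρ 𝕜) (0 : Matrix κ ρ 𝕜)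
      * ⅟(cornerMid E.toBlocks₂₂) * fromBlocks E.toBlocks₂₁ (0 : Matrix ρ κ 𝕜) (0 : Matrix ρ μ 𝕜) (0 : Matrix ρ κ 𝕜)) :=
    (Matrix.invertibleOfIsUnitDet _ h).copy _ hS
  letI : Invertible (fromBlocks (kkt E.toBlocks₁₁ P) (fromBlocks E.toBlocks₁₂ (0 : Matrix μ ρ 𝕜) (0 : Matrix κ ρ 𝕜) (0 : Matrix κ ρ 𝕜))
      (fromBlocks E.toBlocks₂₁ (0 : Matrix ρ κ 𝕜) (0 : Matrix ρ μ 𝕜) (0 : Matrix ρ κ 𝕜)) (cornerMid E.toBlocks₂₂)) :=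
    Matrix.fromBlocks₂₂Invertible _ _ _ _
  have e := congrArg Matrix.toBlocks₁₁ (Matrix.invOf_fromBlocks₂₂_eq (kkt E.toBlocks₁₁ P)
    (fromBlocks E.toBlocks₁₂ (0 : Matrix μ ρ 𝕜) (0 : Matrix κ ρ 𝕜) (0 : Matrix κ ρ 𝕜))
    (fromBlocks E.toBlocks₂₁ (0 : Matrix ρ κ 𝕜) (0 : Matrix ρ μ 𝕜) (0 : Matrix ρ κ 𝕜)) (cornerMid E.toBlocks₂₂))
  rw [toBlocks_fromBlocks₁₁] at e
  simp only [Matrix.invOf_eq_nonsing_inv] at e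
  rw [Matrix.inv_eq_right_inv (cornerMid_mul_cornerMidInv E.toBlocks₂₂), hz, sub_zero] at e
  rw [← e, kkt_killRows_eq_submatrix E P, Matrix.inv_submatrix_equiv, Matrix.submatrix_submatrix]
  congr 1
  ext i j
  simp only [submatrix_apply, Function.comp_apply, Equiv.apply_symm_apply]

/-- [folklore] **THE `ρ`-KILLING ROWS DROP OUT OF THE EFFECTIVE FORM**: `(effForm E [[P,0],[0,1]]).toBlocks₁₁ = effForm E₁₁ P` — the effective form seen by
the `κ`-multipliers of the pinned system is the effective form of the CORNER system (`E₁₁`, `P`). -/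
theorem effForm_killRows_toBlocks₁₁ (E : Matrix (μ ⊕ ρ) (μ ⊕ ρ) 𝕜) (P : Matrix κ μ 𝕜) (h : IsUnit (kkt E.toBlocks₁₁ P).det) :
    (effForm E (fromBlocks P (0 : Matrix κ ρ 𝕜) (0 : Matrix ρ μ 𝕜) (1 : Matrix ρ ρ 𝕜))).toBlocks₁₁ = effForm E.toBlocks₁₁ P := by
  ext k k'
  change -(((kkt E (fromBlocks P (0 : Matrix κ ρ 𝕜) (0 : Matrix ρ μ 𝕜) (1 : Matrix ρ ρ 𝕜)))⁻¹) (Sum.inr (Sum.inl k)) (Sum.inr (Sum.inl k')))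
    = -(((kkt E.toBlocks₁₁ P)⁻¹) (Sum.inr k) (Sum.inr k'))
  rw [← kktInv_killRows_regroup E P h]
  rfl

/-- [folklore] the minimiser of the pinned system, `μ`-rows and `κ`-columns, is the corner system's minimiser. -/
theorem minOp_killRows (E : Matrix (μ ⊕ ρ) (μ ⊕ ρ) 𝕜) (P : Matrix κ μ 𝕜) (h : IsUnit (kkt E.toBlocks₁₁ P).det) :
    (minOp E (fromBlocks P (0 : Matrix κ ρ 𝕜) (0 : Matrix ρ μ 𝕜) (1 : Matrix ρ ρ 𝕜))).submatrix Sum.inl Sum.inl = minOp E.toBlocks₁₁ P := by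
  ext x k
  change ((kkt E (fromBlocks P (0 : Matrix κ ρ 𝕜) (0 : Matrix ρ μ 𝕜) (1 : Matrix ρ ρ 𝕜)))⁻¹) (Sum.inl (Sum.inl x)) (Sum.inr (Sum.inl k))
    = ((kkt E.toBlocks₁₁ P)⁻¹) (Sum.inl x) (Sum.inr k)
  rw [← kktInv_killRows_regroup E P h]
  rfl

/-- [folklore] the fluctuation covariance of the pinned system on the `μ`-variables is the corner system's. -/
theorem flucCov_killRows (E : Matrix (μ ⊕ ρ) (μ ⊕ ρ) 𝕜) (P : Matrix κ μ 𝕜) (h : IsUnit (kkt E.toBlocks₁₁ P).det) :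
    (flucCov E (fromBlocks P (0 : Matrix κ ρ 𝕜) (0 : Matrix ρ μ 𝕜) (1 : Matrix ρ ρ 𝕜))).toBlocks₁₁ = flucCov E.toBlocks₁₁ P := by
  ext x x'
  change ((kkt E (fromBlocks P (0 : Matrix κ ρ 𝕜) (0 : Matrix ρ μ 𝕜) (1 : Matrix ρ ρ 𝕜)))⁻¹) (Sum.inl (Sum.inl x)) (Sum.inl (Sum.inl x'))
    = ((kkt E.toBlocks₁₁ P)⁻¹) (Sum.inl x) (Sum.inl x')
  rw [← kktInv_killRows_regroup E P h]
  rfl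

end Pinning

/-! ## §2 Tower: composite sliced constraint = two sliced integrations -/

section Tower

variable {ν μ κ ρ₁ ρ₂ : Type*} [Fintype ν] [Fintype μ] [Fintype κ] [Fintype ρ₁] [Fintype ρ₂]
  [DecidableEq ν] [DecidableEq μ] [DecidableEq κ] [DecidableEq ρ₁] [DecidableEq ρ₂]

/-- [folklore] the pinned bordered determinant is a unit iff the corner one is. -/
theorem isUnit_det_kkt_killRows_iff (E : Matrix (μ ⊕ ρ₁) (μ ⊕ ρ₁) 𝕜) (P : Matrix (κ ⊕ ρ₂) μ 𝕜) :
    IsUnit (kkt E (fromBlocks P (0 : Matrix (κ ⊕ ρ₂) ρ₁ 𝕜) (0 : Matrix ρ₁ μ 𝕜) (1 : Matrix ρ₁ ρ₁ 𝕜))).det ↔ IsUnit (kkt E.toBlocks₁₁ P).det := by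
  rw [det_kkt_killRows, IsUnit.mul_iff]
  exact ⟨fun h => h.2, fun h => ⟨(isUnit_neg_one.pow _), h⟩⟩

/-- [folklore] **THE TOWER LAW OF SLICED EFFECTIVE FORMS** (product form): with `S := effForm H [Q₁;τ₁]`,
`(effForm H ([[Q₂,0],[τ₂,0],[0,1]] · [Q₁;τ₁])).toBlocks₁₁ = effForm S.toBlocks₁₁ [Q₂;τ₂]` — an5's composition law at `G := 0` followed by pinning. -/
theorem effForm_nested_toBlocks₁₁ (H : Matrix ν ν 𝕜) (Q₁ : Matrix μ ν 𝕜) (τ₁ : Matrix ρ₁ ν 𝕜) (Q₂ : Matrix κ μ 𝕜) (τ₂ : Matrix ρ₂ μ 𝕜)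
    (h1 : IsUnit (kkt H (fromRows Q₁ τ₁)).det)
    (h2 : IsUnit (kkt (effForm H (fromRows Q₁ τ₁)).toBlocks₁₁ (fromRows Q₂ τ₂)).det) :
    (effForm H (fromBlocks (fromRows Q₂ τ₂) (0 : Matrix (κ ⊕ ρ₂) ρ₁ 𝕜) (0 : Matrix ρ₁ μ 𝕜) (1 : Matrix ρ₁ ρ₁ 𝕜) * fromRows Q₁ τ₁)).toBlocks₁₁
      = effForm (effForm H (fromRows Q₁ τ₁)).toBlocks₁₁ (fromRows Q₂ τ₂) := by
  have hc : compForm H (fromRows Q₁ τ₁) 0 = H := by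
    simp [compForm]
  have h2' : IsUnit (kkt (effForm H (fromRows Q₁ τ₁) + 0)
      (fromBlocks (fromRows Q₂ τ₂) (0 : Matrix (κ ⊕ ρ₂) ρ₁ 𝕜) (0 : Matrix ρ₁ μ 𝕜) (1 : Matrix ρ₁ ρ₁ 𝕜))).det := by
    rw [add_zero, isUnit_det_kkt_killRows_iff]
    exact h2
  have e := effForm_compForm H (fromRows Q₁ τ₁) 0
    (fromBlocks (fromRows Q₂ τ₂) (0 : Matrix (κ ⊕ ρ₂) ρ₁ 𝕜) (0 : Matrix ρ₁ μ 𝕜) (1 : Matrix ρ₁ ρ₁ 𝕜)) h1 h2'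
  rw [hc, add_zero] at e
  rw [e, effForm_killRows_toBlocks₁₁ _ _ h2]

/-- [folklore] **THE TOWER LAW, multiplied out**: `(effForm H [[Q₂Q₁; τ₂Q₁]; τ₁]).toBlocks₁₁ = effForm (effForm H [Q₁;τ₁]).toBlocks₁₁ [Q₂;τ₂]`
(`NestedStepLawSliced.nestedSlice_mul_fromRows`). -/
theorem effForm_nested_toBlocks₁₁' (H : Matrix ν ν 𝕜) (Q₁ : Matrix μ ν 𝕜) (τ₁ : Matrix ρ₁ ν 𝕜) (Q₂ : Matrix κ μ 𝕜) (τ₂ : Matrix ρ₂ μ 𝕜)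
    (h1 : IsUnit (kkt H (fromRows Q₁ τ₁)).det)
    (h2 : IsUnit (kkt (effForm H (fromRows Q₁ τ₁)).toBlocks₁₁ (fromRows Q₂ τ₂)).det) :
    (effForm H (fromRows (fromRows (Q₂ * Q₁) (τ₂ * Q₁)) τ₁)).toBlocks₁₁ = effForm (effForm H (fromRows Q₁ τ₁)).toBlocks₁₁ (fromRows Q₂ τ₂) := by
  rw [← nestedSlice_mul_fromRows, effForm_nested_toBlocks₁₁ H Q₁ τ₁ Q₂ τ₂ h1 h2]

/-- [folklore] **THE `κκ` CORNER TWO LEVELS UP**: the effective form the coarsest average sees through the composite sliced constraint is the corner of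
the two-step tower. -/
theorem effForm_nested_corner (H : Matrix ν ν 𝕜) (Q₁ : Matrix μ ν 𝕜) (τ₁ : Matrix ρ₁ ν 𝕜) (Q₂ : Matrix κ μ 𝕜) (τ₂ : Matrix ρ₂ μ 𝕜)
    (h1 : IsUnit (kkt H (fromRows Q₁ τ₁)).det)
    (h2 : IsUnit (kkt (effForm H (fromRows Q₁ τ₁)).toBlocks₁₁ (fromRows Q₂ τ₂)).det) :
    (effForm H (fromRows (fromRows (Q₂ * Q₁) (τ₂ * Q₁)) τ₁)).toBlocks₁₁.toBlocks₁₁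
      = (effForm (effForm H (fromRows Q₁ τ₁)).toBlocks₁₁ (fromRows Q₂ τ₂)).toBlocks₁₁ := by
  rw [effForm_nested_toBlocks₁₁' H Q₁ τ₁ Q₂ τ₂ h1 h2]

/-- [folklore] **RE-INDEXING THE CONSTRAINT ROWS re-indexes the effective form**: `effForm H (C∘(f, id)) = (effForm H C)∘(f, f)`. -/
theorem effForm_submatrix_rows {κ' : Type*} [Fintype κ'] [DecidableEq κ'] {σ : Type*} [Fintype σ] [DecidableEq σ]
    (H : Matrix ν ν 𝕜) (C : Matrix σ ν 𝕜) (f : κ' ≃ σ) :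
    effForm H (C.submatrix f id) = (effForm H C).submatrix f f := by
  ext k k'
  change -(((kkt H (C.submatrix f id))⁻¹) (Sum.inr k) (Sum.inr k')) = -(((kkt H C)⁻¹) (Sum.inr (f k)) (Sum.inr (f k')))
  have hc : (Sum.map (Equiv.refl ν) f : ν ⊕ κ' → ν ⊕ σ) = (Equiv.sumCongr (Equiv.refl ν) f) := rfl
  rw [show C.submatrix f id = C.submatrix f (Equiv.refl ν) from rfl, show H = H.submatrix (Equiv.refl ν) (Equiv.refl ν) from rfl,
    kkt_submatrix_equiv, hc, Matrix.inv_submatrix_equiv]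
  rfl

/-- [folklore] **THE TOWER LAW WITH THE SLICES RE-ASSOCIATED** (the shape of the (j, m+1) torus call: `Q₁₀ := Q_{j+m} · 𝔔^{(m)}`,
`τ₁ := [τ_{j+m} · 𝔔^{(m)}; τ^{(m)}]`): `(effForm H [Q₂Q₁; [τ₂Q₁; τ₁]]).toBlocks₁₁ = (effForm (effForm H [Q₁;τ₁]).toBlocks₁₁ [Q₂;τ₂]).toBlocks₁₁`. -/
theorem effForm_nested_corner_assoc (H : Matrix ν ν 𝕜) (Q₁ : Matrix μ ν 𝕜) (τ₁ : Matrix ρ₁ ν 𝕜) (Q₂ : Matrix κ μ 𝕜) (τ₂ : Matrix ρ₂ μ 𝕜)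
    (h1 : IsUnit (kkt H (fromRows Q₁ τ₁)).det)
    (h2 : IsUnit (kkt (effForm H (fromRows Q₁ τ₁)).toBlocks₁₁ (fromRows Q₂ τ₂)).det) :
    (effForm H (fromRows (Q₂ * Q₁) (fromRows (τ₂ * Q₁) τ₁))).toBlocks₁₁
      = (effForm (effForm H (fromRows Q₁ τ₁)).toBlocks₁₁ (fromRows Q₂ τ₂)).toBlocks₁₁ := by
  rw [fromRows_assoc, effForm_submatrix_rows, ← effForm_nested_corner H Q₁ τ₁ Q₂ τ₂ h1 h2]
  ext k k'
  rfl

omit [Fintype κ] [Fintype ρ₂] [DecidableEq κ] [DecidableEq ρ₂] in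
/-- [folklore] re-associating the constraint rows does not change the bordered determinant. -/
theorem det_kkt_fromRows_assoc {κ' ρ' : Type*} [Fintype κ'] [Fintype ρ'] [DecidableEq κ'] [DecidableEq ρ']
    (H : Matrix ν ν 𝕜) (A : Matrix κ' ν 𝕜) (B : Matrix ρ' ν 𝕜) (C : Matrix ρ₁ ν 𝕜) :
    (kkt H (fromRows A (fromRows B C))).det = (kkt H (fromRows (fromRows A B) C)).det := by
  rw [fromRows_assoc A B C, show H = H.submatrix (Equiv.refl ν) (Equiv.refl ν) from rfl,
    show ((fromRows (fromRows A B) C).submatrix (Equiv.sumAssoc κ' ρ' ρ₁).symm id) =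
      (fromRows (fromRows A B) C).submatrix (Equiv.sumAssoc κ' ρ' ρ₁).symm (Equiv.refl ν) from rfl]
  exact RelInvPeriodisedSliced.det_kkt_submatrix_equiv _ _ _ _

end Tower

/-! ## §3 Scaling: a non-zero scalar on the form scales the effective form -/

section Scaling

variable {ν κ : Type*} [Fintype ν] [Fintype κ] [DecidableEq ν] [DecidableEq κ]

/-- [folklore] **THE BORDERED INVERSE OF A SCALED FORM**: for `c ≠ 0` and `kkt H C` invertible,
`(kkt (c•H) C)⁻¹ = diag(1, c•1) · (kkt H C)⁻¹ · diag(c⁻¹•1, 1)` (`RelInvPeriodisedCoarse.kkt_smul_form_mul`). -/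
theorem kktInv_smul_form {c : 𝕜} (hc : c ≠ 0) (H : Matrix ν ν 𝕜) (C : Matrix κ ν 𝕜) (h : IsUnit (kkt H C).det) :
    (kkt (c • H) C)⁻¹
      = fromBlocks (1 : Matrix ν ν 𝕜) 0 0 (c • (1 : Matrix κ κ 𝕜)) * (kkt H C)⁻¹ * fromBlocks (c⁻¹ • (1 : Matrix ν ν 𝕜)) 0 0 (1 : Matrix κ κ 𝕜) := by
  have hL : fromBlocks (c • (1 : Matrix ν ν 𝕜)) 0 0 (1 : Matrix κ κ 𝕜) * fromBlocks (c⁻¹ • (1 : Matrix ν ν 𝕜)) 0 0 (1 : Matrix κ κ 𝕜) = 1 := by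
    rw [fromBlocks_multiply]
    simp [smul_smul, inv_mul_cancel₀ hc]
  apply Matrix.inv_eq_right_inv
  calc kkt (c • H) C * (fromBlocks (1 : Matrix ν ν 𝕜) 0 0 (c • (1 : Matrix κ κ 𝕜)) * (kkt H C)⁻¹ * fromBlocks (c⁻¹ • (1 : Matrix ν ν 𝕜)) 0 0 (1 : Matrix κ κ 𝕜))
      = kkt (c • H) C * fromBlocks (1 : Matrix ν ν 𝕜) 0 0 (c • (1 : Matrix κ κ 𝕜)) * (kkt H C)⁻¹
          * fromBlocks (c⁻¹ • (1 : Matrix ν ν 𝕜)) 0 0 (1 : Matrix κ κ 𝕜) := by simp only [Matrix.mul_assoc]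
    _ = fromBlocks (c • (1 : Matrix ν ν 𝕜)) 0 0 (1 : Matrix κ κ 𝕜) * (kkt H C * (kkt H C)⁻¹)
          * fromBlocks (c⁻¹ • (1 : Matrix ν ν 𝕜)) 0 0 (1 : Matrix κ κ 𝕜) := by rw [kkt_smul_form_mul, Matrix.mul_assoc (fromBlocks _ _ _ _)]
    _ = 1 := by rw [Matrix.mul_nonsing_inv _ h, Matrix.mul_one, hL]

/-- [folklore] **SCALING OF THE EFFECTIVE FORM**: `effForm (c•H) C = c • effForm H C` for `c ≠ 0` and `kkt H C` invertible. -/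
theorem effForm_smul_form {c : 𝕜} (hc : c ≠ 0) (H : Matrix ν ν 𝕜) (C : Matrix κ ν 𝕜) (h : IsUnit (kkt H C).det) :
    effForm (c • H) C = c • effForm H C := by
  show -((kkt (c • H) C)⁻¹).toBlocks₂₂ = c • -((kkt H C)⁻¹).toBlocks₂₂
  rw [kktInv_smul_form hc H C h]
  conv_lhs => rw [← Matrix.fromBlocks_toBlocks (kkt H C)⁻¹]
  rw [fromBlocks_multiply, fromBlocks_multiply, toBlocks_fromBlocks₂₂]
  simp [Matrix.smul_mul, smul_neg]

/-- [folklore] hence the `μμ` corner scales too: `(effForm (c•H) [Q;τ]).toBlocks₁₁ = c • (effForm H [Q;τ]).toBlocks₁₁`. -/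
theorem effForm_smul_form_toBlocks₁₁ {μ ρ : Type*} [Fintype μ] [Fintype ρ] [DecidableEq μ] [DecidableEq ρ]
    {c : 𝕜} (hc : c ≠ 0) (H : Matrix ν ν 𝕜) (Q : Matrix μ ν 𝕜) (τ : Matrix ρ ν 𝕜) (h : IsUnit (kkt H (fromRows Q τ)).det) :
    (effForm (c • H) (fromRows Q τ)).toBlocks₁₁ = c • (effForm H (fromRows Q τ)).toBlocks₁₁ := by
  rw [effForm_smul_form hc H (fromRows Q τ) h]
  rfl

end Scaling

end Summit.QuantumFields.BalabanUV.Beta.FP.EffFormTower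

end
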